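import Summits.QuantumFields.YangMills.Theorems.UnitScaleTiltProp7ExistRouteAlphaMinGCtrMacroSector
import Summits.QuantumFields.YangMills.Theorems.UnitScaleTiltProp7ExistenceByDensityLimit
import Summits.QuantumFields.YangMills.Theorems.UnitScaleTiltProp7IrreducibleCoarseFieldsDense
import HarnessLib

/-!
# Route `UnitScaleTilt`, crux K1 child «MinimiserStabilityRegPr» (stmt-QuantumFields-19200), skeleton v10, stub `stub_existenceMinimalOrbit` (EX), route (α),
# DENSITY line (★★OWNER RULING g28-№8 (B)) — **(D5) THE DENSITY KNIT: the `stub_existenceMinimalOrbit` body at `(L, B₃)` from the S7′ chain's two rows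
# `hC` (lifted C-minˢ) and `hV` (COV) — ✓p672002's BYTES, `Lan`∕`Lift` opaque —, ONE bridge row `hIrrLift` («over an IRREDUCIBLE datum every printed-regular
# point of the fibre carries the lift», the reading of ✓p671081) and ONE structural row `hLS` (local surjectivity of the descent at printed-regular points);
# NO `hSymCentre`, no abelian lift, no flux sectors, no new constant**

Cell `ym3-torus`, width seat `ym3-torus-px10` (gen 3).  THEOREMS ONLY (0 `def`, 0 `sorry`).  `--supports stmt-QuantumFields-19200 --as helper`,
count-neutral.  YM₃ on T³ is a ladder rung (R3), not the Clay problem; nothing here claims the stub, the crux, d = 4 or the mass gap.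

HOW.  Sector `Sec F n V := «every V-parallel M₂(ℂ)-section is scalar»` (intertwining form `cf(b₋)·V(b) = V(b)·cf(b₊)`).  (i) ✓`…GCtrMacroSector.isMinOn_macroSector_of_CminG_covCtr`
with its sector re-centring row `hS` INHABITED by `U₁ := U₀` through `hIrrLift` ⇒ MIN-MACRO on the sector; (ii) ✓`…IrreducibleCoarseFieldsDense.dense_irreducible_T3` ⇒ DENSE;
(iii) ✓p674041 `…ExistenceByDensityLimit.existenceMinimalOrbit_of_macroSector_dense_localSurj` ⇒ the stub body.

WHAT IS PROVED (sorry-free, no definition; ns `…Theorems.Prop7StubEXOfDensity`):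
★★★ `existenceMinimalOrbit_of_CminG_cov_irrLift_localSurj (hL) (hB₃) (Lan) (Lift) (hC) (hV) (hIrrLift) (hLS) : <stub body at (L, B₃) VERBATIM>` —
`hC`∕`hV` = ✓p672002's; `hIrrLift : ∃ aI > 0, ∀ i ε₁, 0 < ε₁ → ε₁ ≤ aI → ∀ V U₀, Sec V → PlaqSmall ε₁ V → RegPr (L³B₃ε₁) U₀ → U₀ ∈ 𝔅_k(V) → Lift i U₀` (supplier for the
`Lift` text of record: ✓p671081 `hLift_of_onlyScalarParallel` + ✓`descendTo_eq_fieldShift_emlIterU_of_regPr`, sibling file `…StubEXOfDensityLift`); `hLS` = ✓p674041 §3's.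

HONEST SCOPE.  Composition by name; `hC`, `hV`, `hIrrLift`, `hLS` are DISPLAYED (hypotheses); nothing of [Balaban1985Variational] is asserted; the stub is NOT closed by this
file (its rows are the S7′ chain's, supplied elsewhere); YM₃ on T³ = rung R3 — not d = 4, not infinite volume, not a mass gap, not Clay.

References: T. Bałaban, CMP 102 (1985) 277–309 [Balaban1985Variational] (Prop. 7 p.299, (2)–(8) pp.278–279, (14) p.280); CMP 99 (1985) 75–102 [Balaban1985RegularSpaces]
(Thm 2 p.83, (1.19) p.79).
-/

set_option autoImplicit false

noncomputable section

open Set Filter Topology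
open scoped Matrix.Norms.L2Operator

namespace Summit.QuantumFields.YangMills.Theorems.Prop7StubEXOfDensity

open Literature.MathematicalPhysics.QuantumFieldTheory.Balaban1983to89
open Literature.MathematicalPhysics.QuantumFieldTheory.Balaban1983to89.T3ContinuumYM3Torus
open Literature.MathematicalPhysics.QuantumFieldTheory.Balaban1983to89.T3UnitLawDensityEML (ℰp)
open Literature.MathematicalPhysics.QuantumFieldTheory.Balaban1983to89.T3ConstrainedMinimiser
open Literature.MathematicalPhysics.QuantumFieldTheory.Balaban1983to89.T3TiltDescent
open Literature.MathematicalPhysics.QuantumFieldTheory.Balaban1983to89.T3PrintedRegularMinimiser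
open Literature.MathematicalPhysics.QuantumFieldTheory.Balaban1983to89.T3Thm1Carrier
open Literature.MathematicalPhysics.QuantumFieldTheory.Balaban1983to89.T3SectALandauChart
open Summit.QuantumFields.YangMills.Theorems.Prop7TPrint
open Summit.QuantumFields.YangMills.Theorems.Prop7SPrint
open Summit.QuantumFields.YangMills.Theorems.Prop7ExistRouteAlphaMinGCtrMacroSector (isMinOn_macroSector_of_CminG_covCtr)
open Summit.QuantumFields.YangMills.Theorems.Prop7ExistenceByDensityLimit (existenceMinimalOrbit_of_macroSector_dense_localSurj)
open Summit.QuantumFields.YangMills.Theorems.Prop7IrreducibleCoarseFieldsDense (dense_irreducible_T3)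

variable {L : ℕ}

/-- ★★★ **EX ON THE DENSITY ROAD — the `stub_existenceMinimalOrbit` body at `(L, B₃)` from the S7′ rows `hC` (lifted C-minˢ), `hV` (COV), the bridge row
`hIrrLift` and local surjectivity `hLS`.**  The sector is the set of IRREDUCIBLE data (every `V`-parallel `M₂(ℂ)`-section scalar); on it the re-centring row of
✓p672002 is inhabited by the stub's own background (`hIrrLift`), so MACRO-SECTOR holds (✓`isMinOn_macroSector_of_CminG_covCtr`); irreducible data are dense
(✓`dense_irreducible_T3`); and ✓p674041's limit lemma turns MACRO on a dense sector + `hLS` into the stub body (`O₁ ↦ 2O₁`).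
[cite: Balaban1985Variational, Prop. 7 p.299, (2)-(8) pp.278-279, (14) p.280; Balaban1985RegularSpaces, Thm 2 p.83, (1.19) p.79] -/
theorem existenceMinimalOrbit_of_CminG_cov_irrLift_localSurj (hL : 1 < L) {B₃ : ℝ} (hB₃ : 4 < B₃)
    (Lan : ∀ i : Idx L, GaugeField (i.1.1.P i.1.2.2) 0 (Matrix.specialUnitaryGroup (Fin 2) ℂ) → (PBond (i.1.1.P i.1.2.2) 0 → Matrix (Fin 2) (Fin 2) ℂ) → Prop)
    (Lift : ∀ i : Idx L, GaugeField (i.1.1.P i.1.2.2) 0 (Matrix.specialUnitaryGroup (Fin 2) ℂ) → Prop)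
    (hC : ∃ B₀ a₄ : ℝ, 0 < B₀ ∧ 0 < a₄ ∧ ∀ (i : Idx L) (ε₁ ε₄ : ℝ), 0 < ε₁ → ε₄ ≤ a₄ → 2 * B₀ * (L : ℝ) ^ 3 * B₃ * ε₁ ≤ ε₄ →
        ∀ (V : GaugeField (i.1.1.P i.1.2.1) 0 (Matrix.specialUnitaryGroup (Fin 2) ℂ)) (U₀ : GaugeField (i.1.1.P i.1.2.2) 0 (Matrix.specialUnitaryGroup (Fin 2) ℂ)),
          PlaqSmall ε₁ V → RegPr i.1.1 i.1.2.1 i.1.2.2 ((L : ℝ) ^ 3 * B₃ * ε₁) U₀ → CloseAvg i.1.1 i.1.2.1 i.1.2.2 i.2.2.le ((L : ℝ) ^ 3 * ε₁) V U₀ → Lift i U₀ →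
          ∃ X : PBond (i.1.1.P i.1.2.2) 0 → Matrix (Fin 2) (Fin 2) ℂ,
            nMax19 i.1.1 i.1.2.1 i.1.2.2 U₀ X < 3 * B₀ * (L : ℝ) ^ 3 * B₃ * ε₁ ∧ (∀ b : PBond (i.1.1.P i.1.2.2) 0, (X b).IsHermitian ∧ Matrix.trace (X b) = 0) ∧
            AvgCondPrintS i.1.1 i.1.2.1 i.1.2.2 i.2.2.le V U₀ X ∧ Lan i U₀ X ∧
            ∀ X' : PBond (i.1.1.P i.1.2.2) 0 → Matrix (Fin 2) (Fin 2) ℂ, nMax19 i.1.1 i.1.2.1 i.1.2.2 U₀ X' < ε₄ → (∀ b : PBond (i.1.1.P i.1.2.2) 0, (X' b).IsHermitian ∧ Matrix.trace (X' b) = 0) →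
              AvgCondPrint i.1.1 i.1.2.1 i.1.2.2 i.2.2.le V U₀ X' → IsLandauPrint i.1.1 i.1.2.1 i.1.2.2 U₀ X' →
                wilsonAction4 (emb15 U₀ (expHermField X)) ≤ wilsonAction4 (emb15 U₀ (expHermField X')))
    (hV : ∃ B₁ c₁ : ℝ, 0 < B₁ ∧ 0 < c₁ ∧ ∀ (F : T3Family) (hF : F.L = L) (n K : ℕ) (hnK : n < K) (ε₀ ε₁ ε₂ : ℝ), 0 < ε₀ → 0 < ε₁ →
        ε₀ + (L : ℝ) ^ 3 * ε₁ ≤ c₁ → B₁ * (ε₀ + (L : ℝ) ^ 3 * ε₁) ≤ ε₂ →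
        ∀ (V : GaugeField (F.P n) 0 (Matrix.specialUnitaryGroup (Fin 2) ℂ)) (U₀ : GaugeField (F.P K) 0 (Matrix.specialUnitaryGroup (Fin 2) ℂ)),
          RegPr F n K ((L : ℝ) ^ 3 * B₃ * ε₁) U₀ → CloseAvg F n K hnK.le ((L : ℝ) ^ 3 * ε₁) V U₀ →
          ∀ U : GaugeField (F.P K) 0 (Matrix.specialUnitaryGroup (Fin 2) ℂ), U ∈ regFibrePr F n K hnK.le ε₀ V → IsAxialPrint F n K U₀ U →
            ∃ (u : GaugeTransf (F.P K) 0 (Matrix.specialUnitaryGroup (Fin 2) ℂ)) (U₁ : GaugeField (F.P K) 0 (Matrix.specialUnitaryGroup (Fin 2) ℂ))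
              (X : PBond (F.P K) 0 → Matrix (Fin 2) (Fin 2) ℂ),
              RestrictedPrint F n K U₀ u ∧ GaugeField.gaugeAct u (emb15 U₀ U₁) = U ∧ In19 F n K ε₂ U₀ U₁ X ∧
                AvgCondPrint F n K hnK.le V U₀ X ∧ IsLandauPrint F n K U₀ X)
    -- BRIDGE ROW (displayed; supplier for the `Lift` text of record = the sibling file): over an irreducible datum every printed-regular fibre point carries the lift
    (hIrrLift : ∃ aI : ℝ, 0 < aI ∧ ∀ (i : Idx L) (ε₁ : ℝ), 0 < ε₁ → ε₁ ≤ aI →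
        ∀ (V : GaugeField (i.1.1.P i.1.2.1) 0 (Matrix.specialUnitaryGroup (Fin 2) ℂ)) (U₀ : GaugeField (i.1.1.P i.1.2.2) 0 (Matrix.specialUnitaryGroup (Fin 2) ℂ)),
          (∀ cf : Site (i.1.1.P i.1.2.1) 0 → Matrix (Fin 2) (Fin 2) ℂ,
              (∀ e : PBond (i.1.1.P i.1.2.1) 0, cf e.src * ((V e : Matrix.specialUnitaryGroup (Fin 2) ℂ) : Matrix (Fin 2) (Fin 2) ℂ) =
                ((V e : Matrix.specialUnitaryGroup (Fin 2) ℂ) : Matrix (Fin 2) (Fin 2) ℂ) * cf e.tgt) →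
              ∃ z : ℂ, ∀ y : Site (i.1.1.P i.1.2.1) 0, cf y = z • (1 : Matrix (Fin 2) (Fin 2) ℂ)) →
          PlaqSmall ε₁ V → RegPr i.1.1 i.1.2.1 i.1.2.2 ((L : ℝ) ^ 3 * B₃ * ε₁) U₀ → U₀ ∈ fibre i.1.1 ℰp i.1.2.1 i.1.2.2 i.2.2.le V → Lift i U₀)
    -- LOCAL SURJECTIVITY of the descent at printed-regular points (displayed; supplier = the (47) chart at a regular centre)
    (hLS : ∃ aR : ℝ, 0 < aR ∧ ∀ (F : T3Family), F.L = L → ∀ (n K : ℕ) (hnK : n < K) (ρ : ℝ), ρ ≤ aR →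
      ∀ U' : GaugeField (F.P K) 0 (Matrix.specialUnitaryGroup (Fin 2) ℂ), RegPr F n K ρ U' →
        ∀ N ∈ 𝓝 U', ∀ᶠ V' in 𝓝 (descendTo F ℰp n K hnK.le U'), ∃ U'' ∈ N, U'' ∈ fibre F ℰp n K hnK.le V') :
    ∃ a₁' O₁ : ℝ, 0 < a₁' ∧ 1 ≤ O₁ ∧
    ∀ (F : T3Family), F.L = L → ∀ (n K : ℕ) (hnK : n < K) (ε₁ : ℝ), 0 < ε₁ →
      ∀ V : GaugeField (F.P n) 0 (Matrix.specialUnitaryGroup (Fin 2) ℂ), PlaqSmall ε₁ V →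
        ∀ U₀ : GaugeField (F.P K) 0 (Matrix.specialUnitaryGroup (Fin 2) ℂ), RegPr F n K ((L : ℝ) ^ 3 * B₃ * ε₁) U₀ → U₀ ∈ fibre F ℰp n K hnK.le V →
          ε₁ ≤ a₁' → ∃ U ∈ regFibrePr F n K hnK.le (O₁ * (L : ℝ) ^ 3 * B₃ * ε₁) V,
            IsMinOn (fun W : GaugeField (F.P K) 0 (Matrix.specialUnitaryGroup (Fin 2) ℂ) => wilsonAction4 W)
              (regFibrePr F n K hnK.le (O₁ * (L : ℝ) ^ 3 * B₃ * ε₁) V) U := by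
  obtain ⟨aI, haI, HI⟩ := hIrrLift
  -- (i) MACRO on the irreducible sector: the re-centring row is inhabited by the background itself
  have hmacro := isMinOn_macroSector_of_CminG_covCtr hL hB₃ Lan Lift hC hV
    (fun (F : T3Family) (n : ℕ) (V : GaugeField (F.P n) 0 (Matrix.specialUnitaryGroup (Fin 2) ℂ)) =>
      ∀ cf : Site (F.P n) 0 → Matrix (Fin 2) (Fin 2) ℂ,
        (∀ e : PBond (F.P n) 0, cf e.src * ((V e : Matrix.specialUnitaryGroup (Fin 2) ℂ) : Matrix (Fin 2) (Fin 2) ℂ) =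
          ((V e : Matrix.specialUnitaryGroup (Fin 2) ℂ) : Matrix (Fin 2) (Fin 2) ℂ) * cf e.tgt) →
        ∃ z : ℂ, ∀ y : Site (F.P n) 0, cf y = z • (1 : Matrix (Fin 2) (Fin 2) ℂ))
    ⟨aI, haI, fun i ε₁ hε₁ hε₁a V U₀ hSec hVreg hU₀ hfib => ⟨U₀, hfib, hU₀, HI i ε₁ hε₁ hε₁a V U₀ hSec hVreg hU₀ hfib⟩⟩
  -- (ii) density of the sector and (iii) the limit lemma
  exact existenceMinimalOrbit_of_macroSector_dense_localSurj hL hB₃ _ hmacro (dense_irreducible_T3 L) hLS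

end Summit.QuantumFields.YangMills.Theorems.Prop7StubEXOfDensity

end
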